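import Mathlib
import Literature.Probability.Percolation.SharpnessDCTProofs
import HarnessLib

/-!
# Crux `PercNearOneGluing.NearOneGluing` (stmt-CriticalPhenomena-4574), line `live-seal-vanishing-sprinkle`
# — stub `stub_smallPockets`, auxiliary file

Helper file for the crux skeleton `Cruxes/NearOneGluing/Lines/live-seal-vanishing-sprinkle.lean`
(lead prover-line-stmt-CriticalPhenomena-4574-a1-0), serving the registered stub
`stub_smallPockets` (small pockets are harmless), whose per-pocket bound and assembly are in the
companion file `PercNearOneGluingNearOneGluingSmallPockets.lean`.  Lands with
`--supports stmt-CriticalPhenomena-4574`.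

## Contents

* **Rooted parent maps** of a finite vertex set `S₀ ∋ o` of the complete graph on `Fin n`: maps
  `p : Fin n → Fin n` with `p(S₀) ⊆ S₀`, `p = id` off `S₀`, and a rank decreasing along
  `v ↦ p v` on `S₀ ∖ {o}`.  They number at most `|S₀| ^ |S₀|` (`smallPockets_card_maps`); if
  all tree pairs `s(p v, v)` (`v ∈ S₀ ∖ {o}`) are open then `S₀` is internally `o`-spanned
  (`smallPockets_pathIn_of_rank`), and conversely an internally `o`-spanned `S₀` carries a rooted
  parent map with open tree pairs (`smallPockets_exists_parent`, growing a tree by first exits);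
  with the boundary pairs of `S₀` closed, the relay-free pocket of `o` is then exactly `S₀`
  (`smallPockets_pocket_of_tree`).
* **Real-variable inequalities**: the interpolation `X ≤ tM`, `X ≤ κM` ⇒ `X ≤ t^s κ^{1-s} M`
  (`smallPockets_interp`), the un-boosted weights `w₁ = 1 - (1 - w)^{1-s} ∈ [0, 1]`
  (`smallPockets_exists_unboost`) and Bernoulli's inequality `w ≤ w₁ / (1 - s)` in product form
  (`smallPockets_prod_le`).
-/

namespace Summit.CriticalPhenomena.PercolationContinuityZ3.Theorems

open scoped BigOperators Classical
open Set
open Literature.Probability.Percolation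

/-! ### Rooted parent maps -/

section ParentMaps

variable {n : ℕ}

/-- **Entropy count.** The maps `Fin n → Fin n` sending `S₀` into `S₀` and fixing every vertex
outside `S₀` number at most `|S₀| ^ |S₀|`. -/
theorem smallPockets_card_maps (S₀ : Finset (Fin n)) :
    ((Finset.univ : Finset (Fin n → Fin n)).filter
        (fun p => (∀ v ∈ S₀, p v ∈ S₀) ∧ ∀ v ∉ S₀, p v = v)).card ≤ S₀.card ^ S₀.card := by
  calc ((Finset.univ : Finset (Fin n → Fin n)).filter
        (fun p => (∀ v ∈ S₀, p v ∈ S₀) ∧ ∀ v ∉ S₀, p v = v)).card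
      ≤ (Fintype.piFinset fun v : Fin n => if v ∈ S₀ then S₀ else {v}).card := by
        refine Finset.card_le_card fun p hp => ?_
        rw [Finset.mem_filter] at hp
        rw [Fintype.mem_piFinset]
        intro v
        by_cases hv : v ∈ S₀
        · rw [if_pos hv]; exact hp.2.1 v hv
        · rw [if_neg hv, Finset.mem_singleton]; exact hp.2.2 v hv
    _ = S₀.card ^ S₀.card := by
        rw [Fintype.card_piFinset]
        have h : ∀ v, (if v ∈ S₀ then S₀ else {v} : Finset (Fin n)).card =
            if v ∈ S₀ then S₀.card else 1 := by
          intro v; split_ifs <;> simp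
        simp_rw [h]
        rw [Fintype.prod_ite_mem, Finset.prod_const]

/-- **Rooted tree pairs open ⇒ internally spanned.** If `p` maps `S₀` into `S₀`, a rank
decreases along `v ↦ p v` on `S₀ ∖ {o}`, and every tree pair `s(p v, v)` (`v ∈ S₀ ∖ {o}`) is
open, then every vertex of `S₀` is joined to `o` by an open path inside `S₀`. -/
theorem smallPockets_pathIn_of_rank {S₀ : Finset (Fin n)} {o : Fin n} {p : Fin n → Fin n}
    {r : Fin n → ℕ} (ho : o ∈ S₀) (hp : ∀ v ∈ S₀, p v ∈ S₀)
    (hr : ∀ v ∈ S₀, v ≠ o → r (p v) < r v) {ω : Set (Sym2 (Fin n))}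
    (hω : ∀ v ∈ S₀, v ≠ o → s(p v, v) ∈ ω) :
    ∀ v ∈ S₀, PathIn (openGraph ω) (↑S₀ : Set (Fin n)) o v := by
  suffices h : ∀ m : ℕ, ∀ v ∈ S₀, r v ≤ m → PathIn (openGraph ω) (↑S₀ : Set (Fin n)) o v from
    fun v hv => h (r v) v hv le_rfl
  intro m
  induction m with
  | zero =>
    intro v hv hrv
    by_cases hvo : v = o
    · rw [hvo]; exact PathIn.refl (Finset.mem_coe.2 ho)
    · exact absurd (hr v hv hvo) (by omega)
  | succ m ih =>
    intro v hv hrv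
    by_cases hvo : v = o
    · rw [hvo]; exact PathIn.refl (Finset.mem_coe.2 ho)
    · have h1 := hr v hv hvo
      have hpv : p v ≠ v := fun h => by rw [h] at h1; exact lt_irrefl _ h1
      refine (ih (p v) (hp v hv) (by omega)).tail ?_ (Finset.mem_coe.2 hv)
      rw [openGraph_adj]
      exact ⟨hω v hv hvo, hpv⟩

/-- **Internally spanned ⇒ some rooted parent map has all its tree pairs open** (grow a rooted
tree from `o` inside `S₀`, one first-exit edge at a time). -/
theorem smallPockets_exists_parent {S₀ : Finset (Fin n)} {o : Fin n} (ho : o ∈ S₀)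
    {ω : Set (Sym2 (Fin n))} (hω : ∀ v ∈ S₀, PathIn (openGraph ω) (↑S₀ : Set (Fin n)) o v) :
    ∃ p : Fin n → Fin n, (∀ v ∈ S₀, p v ∈ S₀) ∧ (∀ v ∉ S₀, p v = v) ∧
      (∃ r : Fin n → ℕ, ∀ v ∈ S₀, v ≠ o → r (p v) < r v) ∧
      ∀ v ∈ S₀, v ≠ o → s(p v, v) ∈ ω := by
  -- rooted trees `R ∋ o` inside `S₀` of every size up to `|S₀|`
  have key : ∀ m : ℕ, m + 1 ≤ S₀.card → ∃ R : Finset (Fin n), R ⊆ S₀ ∧ o ∈ R ∧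
      R.card = m + 1 ∧ ∃ (p : Fin n → Fin n) (r : Fin n → ℕ),
        (∀ v ∈ R, v ≠ o → p v ∈ R ∧ r (p v) < r v ∧ s(p v, v) ∈ ω) ∧
        ∀ v, (v ∉ R ∨ v = o) → p v = v := by
    intro m
    induction m with
    | zero =>
      intro _
      refine ⟨{o}, Finset.singleton_subset_iff.2 ho, Finset.mem_singleton_self o,
        Finset.card_singleton o, id, fun _ => 0, fun v hv hvo => ?_, fun v _ => rfl⟩
      exact absurd (Finset.mem_singleton.1 hv) hvo
    | succ m ih =>
      intro hm
      obtain ⟨R, hRS, hoR, hRc, p, r, hgood, hid⟩ := ih (by omega)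
      obtain ⟨v, hvS, hvR⟩ : ∃ v ∈ S₀, v ∉ R := by
        by_contra h
        push Not at h
        have h' := Finset.card_le_card (show S₀ ⊆ R from h)
        omega
      obtain ⟨a, c, haR, hcR, hcS, hac, -⟩ := (hω v hvS).exit (R := (↑R : Set (Fin n)))
        (Finset.mem_coe.2 hoR) (fun h => hvR (Finset.mem_coe.1 h))
      rw [openGraph_adj] at hac
      have haR' : a ∈ R := Finset.mem_coe.1 haR
      have hcR' : c ∉ R := fun h => hcR (Finset.mem_coe.2 h)
      have hac' : a ≠ c := hac.2
      refine ⟨insert c R, Finset.insert_subset (Finset.mem_coe.1 hcS) hRS,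
        Finset.mem_insert_of_mem hoR, by rw [Finset.card_insert_of_notMem hcR', hRc],
        Function.update p c a, Function.update r c (r a + 1), ?_, ?_⟩
      · intro u hu huo
        rcases Finset.mem_insert.1 hu with rfl | huR
        · rw [Function.update_self, Function.update_self, Function.update_of_ne hac']
          exact ⟨Finset.mem_insert_of_mem haR', Nat.lt_succ_self _, hac.1⟩
        · have huc : u ≠ c := fun h => hcR' (h ▸ huR)
          obtain ⟨hpu, hru, hωu⟩ := hgood u huR huo
          have hpuc : p u ≠ c := fun h => hcR' (h ▸ hpu)
          rw [Function.update_of_ne huc, Function.update_of_ne hpuc, Function.update_of_ne huc]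
          exact ⟨Finset.mem_insert_of_mem hpu, hru, hωu⟩
      · intro u hu
        have huc : u ≠ c := by
          rintro rfl
          rcases hu with hu | hu
          · exact hu (Finset.mem_insert_self _ _)
          · exact hcR' (hu ▸ hoR)
        rw [Function.update_of_ne huc]
        exact hid u (hu.imp_left fun h h' => h (Finset.mem_insert_of_mem h'))
  have hk : 0 < S₀.card := Finset.card_pos.2 ⟨o, ho⟩
  obtain ⟨R, hRS, hoR, hRc, p, r, hgood, hid⟩ := key (S₀.card - 1) (by omega)
  have hRS' : R = S₀ := Finset.eq_of_subset_of_card_le hRS (by omega)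
  subst hRS'
  refine ⟨p, fun v hv => ?_, fun v hv => hid v (Or.inl hv),
    ⟨r, fun v hv hvo => (hgood v hv hvo).2.1⟩, fun v hv hvo => (hgood v hv hvo).2.2⟩
  by_cases hvo : v = o
  · rw [hid v (Or.inr hvo)]; exact hv
  · exact (hgood v hv hvo).1

/-- Membership in the tree cylinder `E_p = {all pairs s(p v, v), v ∈ S₀ ∖ {o}, open}`. -/
theorem smallPockets_subset_iff {S₀ : Finset (Fin n)} {o : Fin n} {p : Fin n → Fin n}
    {ω : Set (Sym2 (Fin n))} :
    (↑((S₀.erase o).image fun v => s(p v, v)) : Set (Sym2 (Fin n))) ⊆ ω ↔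
      ∀ v ∈ S₀, v ≠ o → s(p v, v) ∈ ω := by
  rw [Finset.coe_image, Set.image_subset_iff]
  constructor
  · intro h v hv hvo
    exact h (show v ∈ (↑(S₀.erase o) : Set (Fin n)) from
      Finset.mem_coe.2 (Finset.mem_erase.2 ⟨hvo, hv⟩))
  · intro h v hv
    obtain ⟨hvo, hvS⟩ := Finset.mem_erase.1 (Finset.mem_coe.1 hv)
    exact h v hvS hvo

/-- The cylinder event `{I ⊆ ω}` is determined by the pairs of `I`. -/
theorem smallPockets_determinedBy_subset (I : Finset (Sym2 (Fin n))) :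
    DeterminedBy {ω : Set (Sym2 (Fin n)) | (↑I : Set (Sym2 (Fin n))) ⊆ ω}
      (↑I : Set (Sym2 (Fin n))) := by
  rw [determinedBy_iff]
  intro ω ω' h
  simp only [mem_setOf_eq]
  constructor
  · intro hs e he
    exact ((Set.ext_iff.1 h e).1 ⟨hs he, he⟩).1
  · intro hs e he
    exact ((Set.ext_iff.1 h e).2 ⟨hs he, he⟩).1

/-- **Multiplicity.** If the tree pairs of a rooted parent map of `S₀` are open and the
boundary pairs of `S₀` (towards vertices outside `S₀ ∪ A`) are closed, then the relay-free
pocket of `o` is exactly `S₀`. -/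
theorem smallPockets_pocket_of_tree {S₀ A : Finset (Fin n)} {o : Fin n}
    {F₀ : Finset (Sym2 (Fin n))}
    (hF₀ : ∀ x y, s(x, y) ∈ F₀ ↔ (x ∈ S₀ ∧ y ∉ S₀ ∧ y ∉ A) ∨ (y ∈ S₀ ∧ x ∉ S₀ ∧ x ∉ A))
    (ho : o ∈ S₀) (hSA : Disjoint S₀ A) {ω : Set (Sym2 (Fin n))}
    (hspan : ∀ v ∈ S₀, PathIn (openGraph ω) (↑S₀ : Set (Fin n)) o v)
    (hcl : ∀ e ∈ F₀, e ∉ ω) :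
    ∀ v, ω ∈ openConnIn (↑A : Set (Fin n))ᶜ o v ↔ v ∈ S₀ := by
  have hSU : (↑S₀ : Set (Fin n)) ⊆ (↑A : Set (Fin n))ᶜ := fun v hv hvA =>
    Finset.disjoint_left.1 hSA (Finset.mem_coe.1 hv) (Finset.mem_coe.1 hvA)
  intro v
  constructor
  · intro hv
    by_contra hvS
    obtain ⟨a, c, ha, hc, hcA, hac, -⟩ := (DCT16.pathIn_of_mem_openConnIn hv).exit
      (R := (↑S₀ : Set (Fin n))) (Finset.mem_coe.2 ho) (fun h => hvS (Finset.mem_coe.1 h))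
    rw [openGraph_adj] at hac
    exact hcl _ ((hF₀ a c).2 (Or.inl ⟨Finset.mem_coe.1 ha, fun h => hc (Finset.mem_coe.2 h),
      fun h => hcA (Finset.mem_coe.2 h)⟩)) hac.1
  · intro hv
    exact DCT16.mem_openConnIn_of_pathIn ((hspan v hv).mono hSU)

end ParentMaps

/-! ### Real-variable inequalities and the un-boosted weights -/

section RealIneq

variable {n : ℕ}

/-- Interpolation of two upper bounds: `X ≤ tM` and `X ≤ κM` give `X ≤ t^s κ^{1-s} M`
(`0 < s < 1`, everything nonnegative). -/
theorem smallPockets_interp {X M κ t s : ℝ} (hX : 0 ≤ X) (hM : 0 ≤ M) (hκ : 0 ≤ κ)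
    (ht : 0 ≤ t) (hs0 : 0 < s) (hs1 : s < 1) (h1 : X ≤ t * M) (h2 : X ≤ κ * M) :
    X ≤ t ^ s * κ ^ (1 - s) * M := by
  have hs1' : 0 ≤ 1 - s := by linarith
  have hsum : s + (1 - s) = 1 := by ring
  have hsplit : ∀ y : ℝ, 0 ≤ y → y = y ^ s * y ^ (1 - s) := fun y hy => by
    rw [← Real.rpow_add' hy (show s + (1 - s) ≠ 0 by rw [hsum]; exact one_ne_zero), hsum,
      Real.rpow_one]
  calc X = X ^ s * X ^ (1 - s) := hsplit X hX
    _ ≤ (t * M) ^ s * (κ * M) ^ (1 - s) :=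
        mul_le_mul (Real.rpow_le_rpow hX h1 hs0.le) (Real.rpow_le_rpow hX h2 hs1')
          (Real.rpow_nonneg hX _) (Real.rpow_nonneg (mul_nonneg ht hM) _)
    _ = t ^ s * κ ^ (1 - s) * (M ^ s * M ^ (1 - s)) := by
        rw [Real.mul_rpow ht hM, Real.mul_rpow hκ hM]; ring
    _ = t ^ s * κ ^ (1 - s) * M := by rw [← hsplit M hM]

/-- The un-boosted weights `w₁ = 1 - (1 - w)^{1-s}` exist in `[0, 1]`. -/
theorem smallPockets_exists_unboost (w : Sym2 (Fin n) → unitInterval) {s : ℝ} (hs1 : s < 1) :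
    ∃ w₁ : Sym2 (Fin n) → unitInterval, ∀ e, (w₁ e : ℝ) = 1 - (1 - (w e : ℝ)) ^ (1 - s) := by
  refine ⟨fun e => ⟨1 - (1 - (w e : ℝ)) ^ (1 - s), ?_, ?_⟩, fun e => rfl⟩
  · exact sub_nonneg.2 (Real.rpow_le_one (sub_nonneg.2 (w e).2.2) (sub_le_self _ (w e).2.1)
      (by linarith))
  · exact sub_le_self _ (Real.rpow_nonneg (sub_nonneg.2 (w e).2.2) _)

/-- **Bernoulli.** `w ≤ w₁ / (1 - s)` for the un-boosted weights, whence for a cylinder on at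
most `m` pairs: `∏_{e ∈ I} w e ≤ (∏_{e ∈ I} w₁ e) / (1 - s) ^ m`. -/
theorem smallPockets_prod_le (w : Sym2 (Fin n) → unitInterval) {w₁ : Sym2 (Fin n) → unitInterval}
    {s : ℝ} (hw₁ : ∀ e, (w₁ e : ℝ) = 1 - (1 - (w e : ℝ)) ^ (1 - s)) (hs0 : 0 < s) (hs1 : s < 1)
    (I : Finset (Sym2 (Fin n))) {m : ℕ} (hI : I.card ≤ m) :
    ∏ e ∈ I, (w e : ℝ) ≤ (∏ e ∈ I, (w₁ e : ℝ)) / (1 - s) ^ m := by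
  have h1s : 0 < 1 - s := by linarith
  have hle : ∀ e, (w e : ℝ) ≤ (w₁ e : ℝ) / (1 - s) := fun e => by
    rw [le_div_iff₀ h1s, hw₁ e]
    have h' := rpow_one_add_le_one_add_mul_self (s := -(w e : ℝ))
      (by linarith [(w e).2.2]) (p := 1 - s) h1s.le (by linarith)
    rw [← sub_eq_add_neg] at h'
    linarith
  calc ∏ e ∈ I, (w e : ℝ) ≤ ∏ e ∈ I, ((w₁ e : ℝ) / (1 - s)) :=
        Finset.prod_le_prod (fun e _ => (w e).2.1) fun e _ => hle e
    _ = (∏ e ∈ I, (w₁ e : ℝ)) / (1 - s) ^ I.card := by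
        rw [Finset.prod_div_distrib, Finset.prod_const]
    _ ≤ (∏ e ∈ I, (w₁ e : ℝ)) / (1 - s) ^ m :=
        div_le_div_of_nonneg_left (Finset.prod_nonneg fun e _ => (w₁ e).2.1) (pow_pos h1s _)
          (pow_le_pow_of_le_one h1s.le (by linarith) hI)

end RealIneq

/-- **Entropy count** (registered auxiliary sub-goal `smallPocketsAux` of `stub_smallPockets`):
the maps `Fin n → Fin n` sending a finite vertex set `S₀` into itself and fixing every vertex
outside `S₀` — the parent maps of the rooted spanning trees of `S₀` — number at most
`|S₀| ^ |S₀|`. -/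
theorem smallPocketsAux :
    ∀ (n : ℕ) (S₀ : Finset (Fin n)), ((Finset.univ : Finset (Fin n → Fin n)).filter
      (fun p => (∀ v ∈ S₀, p v ∈ S₀) ∧ ∀ v ∉ S₀, p v = v)).card ≤ S₀.card ^ S₀.card :=
  fun _ S₀ => smallPockets_card_maps S₀

end Summit.CriticalPhenomena.PercolationContinuityZ3.Theorems
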